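import Literature.NumberTheory.Automorphic.HyperspecialUnitaryCartanUnique
import HarnessLib

/-!
# Iwasawa decomposition of the quasi-split unitary group — the torus part is unique: `B ∩ K₀` has unit diagonal,
# and the valuations of the diagonal of `b` in `g = b k` depend only on `g` (Bruhat–Tits 1972 (4.4.3) (1), bijectivity)

Topic `NumberTheory/Automorphic`; namespace `Literature.NumberTheory.Automorphic.HermitianLattice` (lane `lit-hodgefound`,
Track 2 foundations; seat `lit-hodgefound-p11`, generation 36, row g36-#3).  THEOREMS ONLY (D-0026): no definition, no
named fact, no instance, no notation.  Companion of `HyperspecialUnitaryIwasawa` (existence `U(σ, J₀) = B · K₀`; this file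
does not import it): `K` a field, `σ : K →+* K`, `U(σ, H) = unitaryGroupOfForm σ H ≤ GL_N(K)`, and for `Valued K ℤᵐ⁰`
the integral points `K₀ = unitaryInt σ H = U(σ, H) ∩ GL_N(𝒪)` (`HyperspecialUnitaryCartanUnique`); "upper triangular" is
Mathlib's `Matrix.BlockTriangular _ id`; `J₀ = antidiag(1, …, 1) = (StdForm.antidiagonal N).over K`.

## The print

[BruhatTits1972] Prop. (4.4.3) (1) (held text `paper:doi-10-1007-bf02715544`, p0077 = p. 80): «`G = B̂⁰.V.K` (« décomposition
d'Iwasawa de `G` ») et l'application canonique de `V` dans `B̂⁰\G/K` est bijective» — the INJECTIVITY half: the torus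
component of `g = u t k` is determined by `g` up to `T(𝒪) = T ∩ K`.  [Tits1979] §3.3.2.  For `GL_n` this is the tree's
`zpowDiagGL_unique` (`IwasawaDecompositionGL`): «the upper triangular matrix `(u ϖ^m)⁻¹ (u' ϖ^{m'}) = k k'⁻¹ ∈ GL_n(𝒪)` has
diagonal `ϖ^{m'-m}`, its inverse `ϖ^{m-m'}`, and both are integral only if `m = m'`»; the same argument inside `U(σ, H)`.

## What is formalised

* §1 (any field) diagonals of upper triangular elements of `GL_N`: `inv_apply_self_of_blockTriangular`
  (`(b⁻¹)_{ii} = (b_{ii})⁻¹`, via the tree's `Matrix.BlockTriangular.mul_apply_self` and Mathlib's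
  `Matrix.blockTriangular_inv_of_blockTriangular`), `inv_mul_apply_self_of_blockTriangular`.
* §2 (`H = J₀`) **`map_apply_self_mul_apply_rev_of_blockTriangular`** — for `b ∈ U(σ, J₀)` upper triangular,
  `σ(b_{ii}) · b_{rev i, rev i} = 1`: the diagonal of the Borel subgroup lies in the maximal torus
  `{diag(d) : σ(d_i) d_{rev i} = 1}` (so its valuations `a_i = log v(b_{ii})` satisfy `a_{rev i} = -a_i` when `v ∘ σ = v`:
  `v_apply_rev_rev_eq_inv_of_blockTriangular`).
* §3 (`Valued K ℤᵐ⁰`, any `H`) **`v_apply_self_eq_one_of_mem_unitaryInt`** — an upper triangular element of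
  `K₀ = U(σ, H) ∩ GL_N(𝒪)` has UNIT diagonal (`b_{ii}` and `(b⁻¹)_{ii} = b_{ii}⁻¹` are both integral).
* §4 **`v_apply_self_eq_of_upper_mul_unitaryInt_eq`** — UNIQUENESS OF THE TORUS PART: if `b k = b' k'` with `b, b'`
  upper triangular in `U(σ, H)` and `k, k' ∈ K₀`, then `v(b_{ii}) = v(b'_{ii})` for all `i` (`b⁻¹ b' = k k'⁻¹ ∈ B ∩ K₀` has
  unit diagonal `b_{ii}⁻¹ b'_{ii}`); `v_apply_self_eq_of_eq_upper_mul_unitaryInt` (the form `g = b k = b' k'`).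

## References
* [BruhatTits1972] F. Bruhat, J. Tits, *Groupes réductifs sur un corps local I*, Publ. Math. IHÉS 41 (1972), (4.4.3).
* [Tits1979] J. Tits, *Reductive groups over local fields*, Proc. Symp. Pure Math. 33.1 (1979), §3.3.2.
* [Bump1997] D. Bump, *Automorphic Forms and Representations* (1997), Prop. 4.5.2.
* [CartierCorvallis1979] P. Cartier, *Representations of 𝔭-adic groups: a survey*, PSPM 33.1 (1979), §IV (4.2).
-/

noncomputable section

open scoped Valued WithZero Matrix MatrixGroups

namespace Literature.NumberTheory.Automorphic.HermitianLattice

variable {K : Type*} [Field K] {σ : K →+* K} {N : ℕ}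

/-! ## §1 Diagonals of upper triangular invertible matrices -/

/-- For `b ∈ GL_N(K)` upper triangular, `(b⁻¹)_{ii} · b_{ii} = 1` (the inverse is upper triangular and the diagonal is
multiplicative on upper triangular matrices). [cite: Bump1997, Prop. 4.5.2] -/
theorem inv_apply_self_mul_apply_self_of_blockTriangular (b : GL (Fin N) K)
    (hb : (b : Matrix (Fin N) (Fin N) K).BlockTriangular id) (i : Fin N) :
    ((b⁻¹ : GL (Fin N) K) : Matrix (Fin N) (Fin N) K) i i * (b : Matrix (Fin N) (Fin N) K) i i = 1 := by
  letI := b.invertible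
  have hbi : ((b⁻¹ : GL (Fin N) K) : Matrix (Fin N) (Fin N) K).BlockTriangular id := by
    rw [Matrix.coe_units_inv]
    exact Matrix.blockTriangular_inv_of_blockTriangular hb
  rw [← Matrix.BlockTriangular.mul_apply_self hbi hb i, ← Units.val_mul, inv_mul_cancel, Units.val_one,
    Matrix.one_apply_eq]

/-- For `b ∈ GL_N(K)` upper triangular, `(b⁻¹)_{ii} = (b_{ii})⁻¹`. [cite: Bump1997, Prop. 4.5.2] -/
theorem inv_apply_self_of_blockTriangular (b : GL (Fin N) K) (hb : (b : Matrix (Fin N) (Fin N) K).BlockTriangular id)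
    (i : Fin N) :
    ((b⁻¹ : GL (Fin N) K) : Matrix (Fin N) (Fin N) K) i i = ((b : Matrix (Fin N) (Fin N) K) i i)⁻¹ :=
  eq_inv_of_mul_eq_one_left (inv_apply_self_mul_apply_self_of_blockTriangular b hb i)

/-- The inverse of an upper triangular element of `GL_N(K)` is upper triangular. [cite: Bump1997, Prop. 4.5.2] -/
theorem blockTriangular_inv_of_blockTriangular (b : GL (Fin N) K) (hb : (b : Matrix (Fin N) (Fin N) K).BlockTriangular id) :
    ((b⁻¹ : GL (Fin N) K) : Matrix (Fin N) (Fin N) K).BlockTriangular id := by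
  letI := b.invertible
  rw [Matrix.coe_units_inv]
  exact Matrix.blockTriangular_inv_of_blockTriangular hb

/-- Diagonal of `b⁻¹ b'` for upper triangular `b, b'`: `(b⁻¹ b')_{ii} = b_{ii}⁻¹ b'_{ii}`. [cite: Bump1997, Prop. 4.5.2] -/
theorem inv_mul_apply_self_of_blockTriangular (b b' : GL (Fin N) K) (hb : (b : Matrix (Fin N) (Fin N) K).BlockTriangular id)
    (hb' : (b' : Matrix (Fin N) (Fin N) K).BlockTriangular id) (i : Fin N) :
    ((b⁻¹ * b' : GL (Fin N) K) : Matrix (Fin N) (Fin N) K) i i =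
      ((b : Matrix (Fin N) (Fin N) K) i i)⁻¹ * (b' : Matrix (Fin N) (Fin N) K) i i := by
  rw [Units.val_mul, Matrix.BlockTriangular.mul_apply_self (blockTriangular_inv_of_blockTriangular b hb) hb' i,
    inv_apply_self_of_blockTriangular b hb i]

/-! ## §2 The diagonal of the Borel subgroup of `U(σ, J₀)` lies in the maximal torus -/

/-- The `i`-th column of a matrix as `M e_i`, evaluated. [cite: Tits1979, §3.3.2] -/
theorem mulVec_single_one_apply (M : Matrix (Fin N) (Fin N) K) (i s : Fin N) :
    (M.mulVec (Pi.single i 1)) s = M s i := by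
  rw [Matrix.mulVec_single_one]; rfl

/-- **The diagonal of an upper triangular `b ∈ U(σ, J₀)` satisfies `σ(b_{ii}) · b_{rev i, rev i} = 1`**: the `(i, rev i)`
entry of `(σ b)ᵀ J₀ b = J₀`, i.e. `B₀(b e_i, b e_{rev i}) = B₀(e_i, e_{rev i}) = 1`, has the single surviving term `s = i`
(`b_{si} = 0` for `s > i`, `b_{rev s, rev i} = 0` for `s < i`).  So the diagonal of the Borel subgroup is an element
`diag(d)`, `σ(d_i) d_{rev i} = 1`, of the maximal torus of `U(σ, J₀)`. [cite: BruhatTits1972, (4.4.3)] [cite: Tits1979, §3.3.2] -/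
theorem map_apply_self_mul_apply_rev_of_blockTriangular (b : GL (Fin N) K)
    (hbU : b ∈ unitaryGroupOfForm σ ((StdForm.antidiagonal N).over K))
    (hb : (b : Matrix (Fin N) (Fin N) K).BlockTriangular id) (i : Fin N) :
    σ ((b : Matrix (Fin N) (Fin N) K) i i) * (b : Matrix (Fin N) (Fin N) K) (Fin.rev i) (Fin.rev i) = 1 := by
  have h := (mem_unitaryGroupOfForm_antidiagonal_iff b).1 hbU (Pi.single i 1) (Pi.single (Fin.rev i) 1)
  rw [B₀_single_single, if_pos rfl, B₀_apply, Finset.sum_eq_single i] at h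
  · rw [mulVec_single_one_apply, mulVec_single_one_apply] at h
    exact h
  · intro s _ hs
    rw [mulVec_single_one_apply, mulVec_single_one_apply]
    rcases lt_or_gt_of_ne hs with hlt | hgt
    · -- `s < i`: `rev i < rev s`, so `b_{rev s, rev i} = 0`
      rw [hb (show id (Fin.rev i) < id (Fin.rev s) from Fin.rev_lt_rev.2 hlt), mul_zero]
    · -- `i < s`: `b_{s i} = 0`
      rw [hb (show id i < id s from hgt), map_zero, zero_mul]
  · intro h'; exact absurd (Finset.mem_univ i) h'

/-- **`v(b_{rev i, rev i}) = v(b_{ii})⁻¹`** for an upper triangular `b ∈ U(σ, J₀)` when `σ` preserves the valuation: the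
Iwasawa exponents `a_i = log v(b_{ii})` satisfy `a_{rev i} = -a_i`, i.e. lie in the cocharacter lattice of the maximal
split torus (the `V` of [BruhatTits1972] (4.4.3)). [cite: BruhatTits1972, (4.4.3)] [cite: Tits1979, §3.3.2] -/
theorem v_apply_rev_rev_eq_inv_of_blockTriangular [Valued K ℤᵐ⁰] (hvσ : ∀ a, Valued.v (σ a) = Valued.v a)
    (b : GL (Fin N) K) (hbU : b ∈ unitaryGroupOfForm σ ((StdForm.antidiagonal N).over K))
    (hb : (b : Matrix (Fin N) (Fin N) K).BlockTriangular id) (i : Fin N) :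
    Valued.v ((b : Matrix (Fin N) (Fin N) K) (Fin.rev i) (Fin.rev i)) = (Valued.v ((b : Matrix (Fin N) (Fin N) K) i i))⁻¹ := by
  have h := congrArg Valued.v (map_apply_self_mul_apply_rev_of_blockTriangular b hbU hb i)
  rw [map_mul, hvσ, map_one] at h
  exact eq_inv_of_mul_eq_one_right h

/-! ## §3 `B ∩ K₀` has unit diagonal -/

section Valued

variable [Valued K ℤᵐ⁰]

/-- In a linearly ordered commutative group with zero: `x ≤ 1`, `y ≤ 1`, `x y = 1` force `y = 1`. [cite: Bump1997, Prop. 4.5.2] -/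
theorem eq_one_of_le_one_of_mul_eq_one {x y : ℤᵐ⁰} (hx : x ≤ 1) (hy : y ≤ 1) (h : x * y = 1) : y = 1 := by
  refine le_antisymm hy ?_
  calc (1 : ℤᵐ⁰) = x * y := h.symm
    _ ≤ 1 * y := mul_le_mul' hx le_rfl
    _ = y := one_mul y

/-- **An upper triangular element of `K₀ = U(σ, H) ∩ GL_N(𝒪)` has UNIT diagonal**: `b_{ii} ∈ 𝒪` and
`(b⁻¹)_{ii} = b_{ii}⁻¹ ∈ 𝒪` (any `H`; for `H = J₀` this is `B ∩ K₀ ⊆ U · T(𝒪)`, the triviality of unramified characters on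
`B ∩ K₀` that makes Iwasawa-coordinate formulas well defined). [cite: BruhatTits1972, (4.4.3)] [cite: CartierCorvallis1979, §IV (4.2)] -/
theorem v_apply_self_eq_one_of_mem_unitaryInt {H : Matrix (Fin N) (Fin N) K} {b : unitaryGroupOfForm σ H}
    (hbK : b ∈ unitaryInt σ H) (hb : ((b : GL (Fin N) K) : Matrix (Fin N) (Fin N) K).BlockTriangular id) (i : Fin N) :
    Valued.v (((b : GL (Fin N) K) : Matrix (Fin N) (Fin N) K) i i) = 1 := by
  obtain ⟨h1, h2⟩ := mem_unitaryInt_iff.1 hbK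
  have h := congrArg Valued.v (inv_apply_self_mul_apply_self_of_blockTriangular (b : GL (Fin N) K) hb i)
  rw [map_mul, map_one] at h
  exact eq_one_of_le_one_of_mul_eq_one (h2 i i) (h1 i i) h

/-- The diagonal of an upper triangular element of `K₀` consists of non-zero units: `v((b⁻¹)_{ii}) = 1` as well.
[cite: BruhatTits1972, (4.4.3)] -/
theorem v_inv_apply_self_eq_one_of_mem_unitaryInt {H : Matrix (Fin N) (Fin N) K} {b : unitaryGroupOfForm σ H}
    (hbK : b ∈ unitaryInt σ H) (hb : ((b : GL (Fin N) K) : Matrix (Fin N) (Fin N) K).BlockTriangular id) (i : Fin N) :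
    Valued.v ((((b : GL (Fin N) K)⁻¹ : GL (Fin N) K) : Matrix (Fin N) (Fin N) K) i i) = 1 := by
  rw [inv_apply_self_of_blockTriangular _ hb, map_inv₀, v_apply_self_eq_one_of_mem_unitaryInt hbK hb i, inv_one]

/-! ## §4 Uniqueness of the torus part of the Iwasawa decomposition -/

/-- **UNIQUENESS OF THE TORUS PART of the Iwasawa decomposition** ([BruhatTits1972] (4.4.3) (1), «l'application canonique
de `V` dans `B̂⁰\G/K` est bijective», injectivity): if `b k = b' k'` with `b, b' ∈ U(σ, H)` upper triangular and
`k, k' ∈ K₀ = U(σ, H) ∩ GL_N(𝒪)`, then `v(b_{ii}) = v(b'_{ii})` for every `i` — the upper triangular `b⁻¹ b' = k k'⁻¹` lies in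
`B ∩ K₀`, so its diagonal `b_{ii}⁻¹ b'_{ii}` consists of units. [cite: BruhatTits1972, (4.4.3)] [cite: Tits1979, §3.3.2] -/
theorem v_apply_self_eq_of_upper_mul_unitaryInt_eq {H : Matrix (Fin N) (Fin N) K} {b b' k k' : unitaryGroupOfForm σ H}
    (hb : ((b : GL (Fin N) K) : Matrix (Fin N) (Fin N) K).BlockTriangular id)
    (hb' : ((b' : GL (Fin N) K) : Matrix (Fin N) (Fin N) K).BlockTriangular id)
    (hk : k ∈ unitaryInt σ H) (hk' : k' ∈ unitaryInt σ H) (h : b * k = b' * k') (i : Fin N) :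
    Valued.v (((b : GL (Fin N) K) : Matrix (Fin N) (Fin N) K) i i) =
      Valued.v (((b' : GL (Fin N) K) : Matrix (Fin N) (Fin N) K) i i) := by
  -- `u = b⁻¹ b' = k k'⁻¹ ∈ B ∩ K₀`
  have hu : b⁻¹ * b' = k * k'⁻¹ := by
    rw [inv_mul_eq_iff_eq_mul, ← mul_assoc, h, mul_inv_cancel_right]
  have huK : b⁻¹ * b' ∈ unitaryInt σ H := by
    rw [hu]; exact (unitaryInt σ H).mul_mem hk ((unitaryInt σ H).inv_mem hk')
  have hutri : (((b⁻¹ * b' : unitaryGroupOfForm σ H) : GL (Fin N) K) : Matrix (Fin N) (Fin N) K).BlockTriangular id := by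
    rw [Subgroup.coe_mul, Subgroup.coe_inv, Units.val_mul]
    exact (blockTriangular_inv_of_blockTriangular _ hb).mul hb'
  have h1 := v_apply_self_eq_one_of_mem_unitaryInt huK hutri i
  rw [Subgroup.coe_mul, Subgroup.coe_inv, inv_mul_apply_self_of_blockTriangular _ _ hb hb' i, map_mul, map_inv₀] at h1
  have h0 : Valued.v (((b : GL (Fin N) K) : Matrix (Fin N) (Fin N) K) i i) ≠ 0 :=
    (Valuation.ne_zero_iff _).2 (apply_self_ne_zero_of_blockTriangular _ hb i)
  rw [inv_mul_eq_one₀ h0] at h1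
  exact h1

/-- Uniqueness of the torus part, `g = b k = b' k'` form: two Iwasawa decompositions of the same `g ∈ U(σ, H)` have
diagonals with the same valuations. [cite: BruhatTits1972, (4.4.3)] [cite: Tits1979, §3.3.2] -/
theorem v_apply_self_eq_of_eq_upper_mul_unitaryInt {H : Matrix (Fin N) (Fin N) K} {g b b' k k' : unitaryGroupOfForm σ H}
    (hb : ((b : GL (Fin N) K) : Matrix (Fin N) (Fin N) K).BlockTriangular id)
    (hb' : ((b' : GL (Fin N) K) : Matrix (Fin N) (Fin N) K).BlockTriangular id)
    (hk : k ∈ unitaryInt σ H) (hk' : k' ∈ unitaryInt σ H) (hg : g = b * k) (hg' : g = b' * k') (i : Fin N) :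
    Valued.v (((b : GL (Fin N) K) : Matrix (Fin N) (Fin N) K) i i) =
      Valued.v (((b' : GL (Fin N) K) : Matrix (Fin N) (Fin N) K) i i) :=
  v_apply_self_eq_of_upper_mul_unitaryInt_eq hb hb' hk hk' (hg ▸ hg' ▸ rfl) i

/-- Uniqueness for the `K₀ · B` form `g = k b = k' b'`: the diagonals of `b, b'` have the same valuations (apply the
`B · K₀` statement to `g⁻¹ = b⁻¹ k⁻¹`; the diagonal of `b⁻¹` is `b_{ii}⁻¹`). [cite: BruhatTits1972, (4.4.3)] -/
theorem v_apply_self_eq_of_unitaryInt_mul_upper_eq {H : Matrix (Fin N) (Fin N) K} {b b' k k' : unitaryGroupOfForm σ H}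
    (hb : ((b : GL (Fin N) K) : Matrix (Fin N) (Fin N) K).BlockTriangular id)
    (hb' : ((b' : GL (Fin N) K) : Matrix (Fin N) (Fin N) K).BlockTriangular id)
    (hk : k ∈ unitaryInt σ H) (hk' : k' ∈ unitaryInt σ H) (h : k * b = k' * b') (i : Fin N) :
    Valued.v (((b : GL (Fin N) K) : Matrix (Fin N) (Fin N) K) i i) =
      Valued.v (((b' : GL (Fin N) K) : Matrix (Fin N) (Fin N) K) i i) := by
  have h' : b⁻¹ * k⁻¹ = b'⁻¹ * k'⁻¹ := by
    rw [← mul_inv_rev, ← mul_inv_rev, h]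
  have hbi : (((b⁻¹ : unitaryGroupOfForm σ H) : GL (Fin N) K) : Matrix (Fin N) (Fin N) K).BlockTriangular id := by
    rw [Subgroup.coe_inv]; exact blockTriangular_inv_of_blockTriangular _ hb
  have hbi' : (((b'⁻¹ : unitaryGroupOfForm σ H) : GL (Fin N) K) : Matrix (Fin N) (Fin N) K).BlockTriangular id := by
    rw [Subgroup.coe_inv]; exact blockTriangular_inv_of_blockTriangular _ hb'
  have h1 := v_apply_self_eq_of_upper_mul_unitaryInt_eq hbi hbi' ((unitaryInt σ H).inv_mem hk)
    ((unitaryInt σ H).inv_mem hk') h' i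
  rw [Subgroup.coe_inv, Subgroup.coe_inv, inv_apply_self_of_blockTriangular _ hb, inv_apply_self_of_blockTriangular _ hb',
    map_inv₀, map_inv₀, inv_inj] at h1
  exact h1

end Valued

end Literature.NumberTheory.Automorphic.HermitianLattice

end
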